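import Mathlib
import Summits.ValiantsHypothesis.ValiantsHypothesis.Theorems.PermanentalConesPermanentalHyperbolic
import Summits.ValiantsHypothesis.ValiantsHypothesis.Theorems.PermanentalConesPermanentalConeHardSlackAsPermanent
import Summits.ValiantsHypothesis.ValiantsHypothesis.Theorems.PermanentalConesPermanentalConeHardAllOnesNotWitness
import Summits.ValiantsHypothesis.ValiantsHypothesis.Theorems.PermanentalConesPermanentalConeHardTwoRowsColScale
import Literature.AlgebraicGeometry.HyperbolicPolynomials.HyperbolicityCone
import Literature.AlgebraicGeometry.HyperbolicPolynomials.Garding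
import Literature.AlgebraicGeometry.HyperbolicPolynomials.SmoothBoundary
import Literature.AlgebraicGeometry.HyperbolicPolynomials.SpectrahedralShadow
import Literature.AlgebraicGeometry.HyperbolicPolynomials.SpectrahedralShadowProofs
import Literature.Analysis.Convex.ConeLift

/-!
# `PermanentalConeHard` (stmt-ValiantsHypothesis-8654), line `birth` — one positive row is never a witness

Route `PermanentalCones` of `ValiantsHypothesis`, crux `PermanentalConeHard` (H+).  A level-`c`
witness of H+ is a permanental polynomial `Q = per[(Y)_{rows<r}; x^{(N-r)}]` whose closed
hyperbolicity cone `Λ₊(Q, 𝟙)` has NO lifted-LMI description of size `≤ 2^((log₂ N + c)^c)`.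
This file removes the members with ONE entrywise-positive constant row `w` (`r = 1`):
`Q = (N-1)!·D_w e_N`, and column scaling (`stub_rowPermanent_colScale`) plus Gårding's direction
change `w⁻¹ ↝ 𝟙` give

  `Λ₊(Q, 𝟙) = Diag(w) · Λ₊(e_{N-1}^{(N)}, 𝟙)`,

a diagonal image of the first derivative relaxation of the orthant, which has a lifted LMI of
size `≤ 2^((log₂ N + 4)^4)` by the tree's Saunderson–Parrilo recursion
(`hasExpPsdLift_cone_deriv`).  Also: positivity helpers shared with the two-row file
(`permanent_pos`, `mem_openHyperbolicityCone_rowPermanent_of_pos`,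
`mem_openHyperbolicityCone_esymm_of_pos`).

References: Saunderson–Parrilo, Math. Program. 153 (2015) (arXiv:1208.1443) Thm. 1, §2.2;
Gårding 1959 (direction independence).
-/

set_option linter.dupNamespace false

noncomputable section

namespace Summit.ValiantsHypothesis.ValiantsHypothesis.Theorems.PermanentalConesPermanentalConeHard

open MvPolynomial Finset Matrix
open scoped BigOperators Polynomial Matrix
open Literature.AlgebraicGeometry.HyperbolicPolynomials Literature.Analysis.Convex

/-! ## Positivity helpers -/

section Pos

/-- The permanent of an entrywise positive real matrix is positive. [folklore] -/
theorem permanent_pos {m : Type*} [DecidableEq m] [Fintype m] {M : Matrix m m ℝ}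
    (hM : ∀ a b, 0 < M a b) : 0 < M.permanent := by
  unfold Matrix.permanent
  exact Finset.sum_pos (fun σ _ => Finset.prod_pos fun i _ => hM _ _) Finset.univ_nonempty

/-- **Positive vectors lie in the open cone of a positive permanental polynomial**: for
`Y > 0` entrywise and `v > 0`, `per[(Y)_{rows<r}; (v + τ𝟙)^{(N-r)}] > 0` for all `τ ≥ 0`.
[folklore] -/
theorem mem_openHyperbolicityCone_rowPermanent_of_pos {N : ℕ} (Y : Fin N → Fin N → ℝ) (r : ℕ)
    (hY : ∀ i j, 0 < Y i j) {v : Fin N → ℝ} (hv : ∀ j, 0 < v j) :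
    v ∈ openHyperbolicityCone (Matrix.of fun a b : Fin N =>
        if (a : ℕ) < r then C (Y a b) else (X b : MvPolynomial (Fin N) ℝ)).permanent
      (fun _ => (1 : ℝ)) := by
  intro τ hτ
  rw [eval_rowPermanent]
  refine (permanent_pos fun a b => ?_).ne'
  simp only [Matrix.of_apply, Pi.add_apply, Pi.smul_apply, smul_eq_mul, mul_one]
  split_ifs
  · exact hY a b
  · linarith [hv b]

end Pos

/-! ## One positive row -/

section OneRow

/-- `e_d` is positive at an entrywise positive point (`d ≤ N`). [folklore] -/
theorem eval_esymm_pos_of_pos {N d : ℕ} (hd : d ≤ N) {v : Fin N → ℝ} (hv : ∀ j, 0 < v j) :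
    0 < MvPolynomial.eval v (MvPolynomial.esymm (Fin N) ℝ d) := by
  rw [eval_esymm_eq_sum_powersetCard]
  refine Finset.sum_pos (fun t _ => Finset.prod_pos fun i _ => hv i) ?_
  obtain ⟨t, ht⟩ := Finset.exists_subset_card_eq (s := (Finset.univ : Finset (Fin N))) (n := d)
    (by simpa using hd)
  exact ⟨t, Finset.mem_powersetCard.2 ht⟩

/-- Positive vectors lie in the open cone `Λ₊₊(e_d, 𝟙)` (`d ≤ N`). [folklore] -/
theorem mem_openHyperbolicityCone_esymm_of_pos {N d : ℕ} (hd : d ≤ N) {v : Fin N → ℝ}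
    (hv : ∀ j, 0 < v j) :
    v ∈ openHyperbolicityCone (MvPolynomial.esymm (Fin N) ℝ d) (fun _ => (1 : ℝ)) := by
  intro τ hτ
  refine (eval_esymm_pos_of_pos hd fun j => ?_).ne'
  simp only [Pi.add_apply, Pi.smul_apply, smul_eq_mul, mul_one]
  linarith [hv j]

/-- **Registered form (`stub_oneRowNotWitness`, no-go infrastructure of the core
`stub_permanentalGradientPsdRank`).**  A permanental polynomial with ONE entrywise-positive
constant row `w` has `Λ₊(Q, 𝟙) = Diag(w)·Λ₊(e_{N-1}^{(N)}, 𝟙)` (column scaling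
`Q(w∘y) = (N-1)!(∏w)·e_{N-1}(y)`, Gårding's direction change `w⁻¹ ↝ 𝟙`), a diagonal image of the
first derivative relaxation of the orthant, hence a lifted-LMI description of size
`≤ 2^((log₂ N + 4)^4)` (Saunderson–Parrilo, tree: `hasExpPsdLift_cone_deriv`): never a witness.
[cite: SaundersonParrilo2014, Theorem 1] -/
theorem stub_oneRowNotWitness : ∀ (N : ℕ) (Y : Matrix (Fin N) (Fin N) ℝ), (∀ i j, 0 < Y i j) → ∀ P : MvPolynomial (Fin N) ℝ, P = (Matrix.of fun i j : Fin N => if (i : ℕ) < 1 then MvPolynomial.C (Y i j) else MvPolynomial.X j).permanent → ∃ m ≤ 2 ^ ((Nat.log 2 N + 4) ^ 4), ∃ (p : ℕ) (A : (Fin N → ℝ) × (Fin p → ℝ) →ₗ[ℝ] Matrix (Fin m) (Fin m) ℝ) (B : Matrix (Fin m) (Fin m) ℝ), ∀ x : Fin N → ℝ, (∀ τ : ℝ, 0 < τ → MvPolynomial.eval (fun j => x j + τ) P ≠ 0) ↔ ∃ y : Fin p → ℝ, (A (x, y) + B).PosSemidef := by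
  classical
  intro N Y hY P hP
  rcases Nat.lt_or_ge N 2 with hN | hN
  · /- `N ≤ 1`: every row is constant, `P = C (per Y) > 0`, the cone is everything (size `0`). -/
    have hmat : (Matrix.of fun i j : Fin N =>
        if (i : ℕ) < 1 then C (Y i j) else (X j : MvPolynomial (Fin N) ℝ)) =
        (Matrix.of fun i j : Fin N => Y i j).map C := by
      ext i j
      have hi : (i : ℕ) < 1 := by omega
      simp only [Matrix.of_apply, Matrix.map_apply, if_pos hi]
    have hconst : P = C ((Matrix.of fun i j : Fin N => Y i j).permanent) := by
      rw [hP, hmat, ← Theorems.ringHom_map_permanent]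
    refine ⟨0, Nat.zero_le _, ?_⟩
    obtain ⟨p, A, B, h⟩ :=
      (isSpectrahedralShadowOfSize_univ_zero : IsSpectrahedralShadowOfSize (Set.univ : Set (Fin N → ℝ)) 0)
    refine ⟨p, A, B, fun x => ?_⟩
    rw [← h x]
    simp only [Set.mem_univ, iff_true]
    intro τ _
    rw [hconst, MvPolynomial.eval_C]
    exact (permanent_pos fun a b => by simpa using hY a b).ne'
  · /- `N = n + 1 ≥ 2`. -/
    obtain ⟨n, rfl⟩ : ∃ n, N = n + 1 := ⟨N - 1, by omega⟩
    set i0 : Fin (n + 1) := ⟨0, by omega⟩ with hi0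
    set w : Fin (n + 1) → ℝ := fun j => Y i0 j with hw
    have hwne : ∀ j, w j ≠ 0 := fun j => (hY i0 j).ne'
    set winv : Fin (n + 1) → ℝ := fun j => (w j)⁻¹ with hwinv
    have hwinvpos : ∀ j, 0 < winv j := fun j => inv_pos.2 (hY i0 j)
    -- the rescaled member is `c • e_n`
    obtain ⟨c, hc, hce⟩ := AllOnes.rowPermanent_eq_C_mul_esymm (n + 1) 1
    have hce' : (Matrix.of fun i j : Fin (n + 1) =>
        if (i : ℕ) < 1 then C (1 : ℝ) else (X j : MvPolynomial (Fin (n + 1)) ℝ)).permanent =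
        C c * MvPolynomial.esymm (Fin (n + 1)) ℝ n := by
      rw [hce, Nat.add_sub_cancel]
    have hscaled : (Matrix.of fun i j : Fin (n + 1) =>
        if (i : ℕ) < 1 then MvPolynomial.C (Y i j * (w j)⁻¹) else MvPolynomial.X j).permanent =
        C c * MvPolynomial.esymm (Fin (n + 1)) ℝ n := by
      rw [← hce']
      congr 1
      refine Matrix.ext fun i j => ?_
      simp only [Matrix.of_apply]
      split_ifs with h1
      · have hi : i = i0 := Fin.ext (by simp only [hi0]; omega)
        have h2 : Y i0 j * (Y i0 j)⁻¹ = 1 := mul_inv_cancel₀ (hwne j)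
        rw [hi, h2]
      · rfl
    -- Step A: column scaling
    have hA : ∀ x : Fin (n + 1) → ℝ,
        (∀ τ : ℝ, 0 < τ → MvPolynomial.eval (fun j => x j + τ) P ≠ 0) ↔
          (fun j => (w j)⁻¹ * x j) ∈
            hyperbolicityCone (MvPolynomial.esymm (Fin (n + 1)) ℝ n) winv := by
      intro x
      rw [mem_hyperbolicityCone_iff]
      refine forall_congr' fun τ => forall_congr' fun _ => ?_
      have hxτ : (fun j => x j + τ) = fun j => w j * ((w j)⁻¹ * x j + τ * (w j)⁻¹) := by
        funext j
        rw [mul_add, mul_inv_cancel_left₀ (hwne j), mul_comm τ, mul_inv_cancel_left₀ (hwne j)]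
      have hpt : ((fun j => (w j)⁻¹ * x j) + τ • winv) = fun j => (w j)⁻¹ * x j + τ * (w j)⁻¹ := by
        funext j
        simp [hwinv]
      rw [hP, hxτ, stub_rowPermanent_colScale (n + 1) 1 Y w _ hwne, hscaled, hpt, map_mul,
        MvPolynomial.eval_C]
      have hprod : (∏ j, w j) ≠ 0 := Finset.prod_ne_zero_iff.2 fun j _ => hwne j
      constructor
      · intro h h0
        exact h (by rw [h0, mul_zero, mul_zero])
      · intro h h0
        rcases mul_eq_zero.1 h0 with h0 | h0
        · exact hprod h0
        · rcases mul_eq_zero.1 h0 with h0 | h0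
          · exact hc.ne' h0
          · exact h h0
    -- Step B: direction change `w⁻¹ ↝ 𝟙`
    have hd : n ≤ Fintype.card (Fin (n + 1)) := by simp
    have hB : hyperbolicityCone (MvPolynomial.esymm (Fin (n + 1)) ℝ n) winv =
        hyperbolicityCone (MvPolynomial.esymm (Fin (n + 1)) ℝ n) (fun _ => (1 : ℝ)) :=
      hyperbolicityCone_eq_of_mem (esymm_isHomogeneous ℝ n) (isHyperbolic_esymm hd)
        (mem_openHyperbolicityCone_esymm_of_pos (by omega) hwinvpos)
    -- the diagonal scaling as a linear map
    let D : (Fin (n + 1) → ℝ) →ₗ[ℝ] (Fin (n + 1) → ℝ) :=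
      { toFun := fun x j => (w j)⁻¹ * x j
        map_add' := fun x x' => by funext j; simp [mul_add]
        map_smul' := fun r x => by funext j; simp; ring }
    have hKset : D ⁻¹' hyperbolicityCone (MvPolynomial.esymm (Fin (n + 1)) ℝ n) (fun _ => (1 : ℝ)) =
        {x : Fin (n + 1) → ℝ | ∀ τ : ℝ, 0 < τ → MvPolynomial.eval (fun j => x j + τ) P ≠ 0} := by
      ext x
      show D x ∈ hyperbolicityCone (MvPolynomial.esymm (Fin (n + 1)) ℝ n) (fun _ => (1 : ℝ)) ↔
        ∀ τ : ℝ, 0 < τ → MvPolynomial.eval (fun j => x j + τ) P ≠ 0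
      rw [hA x, hB]
      exact Iff.rfl
    -- Step E: the lift
    have hcone := hasExpPsdLift_cone_deriv n 1
    have hlift : HasExpPsdLift
        {x : Fin (n + 1) → ℝ | ∀ τ : ℝ, 0 < τ → MvPolynomial.eval (fun j => x j + τ) P ≠ 0} 0
          (n + 1 * (2 + (n + 1) * (2 * (n + 1) + 1))) := by
      rw [← hKset]
      exact hcone.comap_linearMap D
    obtain ⟨p, A, B, hrep⟩ := isSpectrahedralShadowOfSize_of_hasExpPsdLift hlift
    refine ⟨_, ?_, p, A, B, fun x => hrep x⟩
    have hs := AllOnes.size_le (n + 1) 1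
    have h2 : min 1 (n + 1) = 1 := min_eq_left (by omega)
    rw [h2, Nat.add_sub_cancel] at hs
    exact hs

end OneRow

end Summit.ValiantsHypothesis.ValiantsHypothesis.Theorems.PermanentalConesPermanentalConeHard

end
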